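import Literature.NumberTheory.EllipticCurves.AnticyclotomicInertiaAboveP
import Literature.NumberTheory.EllipticCurves.AnticyclotomicSignedLocalConditions
import Literature.GroupTheory.ProcyclicImageBridges
import Literature.NumberTheory.GaloisRepresentations.DegreeOnePlacesProofs
import HarnessLib

/-!
# Stub (a) `stub_xAcTorsionSS` of line `bdpline` (crux `AnticyclotomicEisensteinDivisibility`,
# stmt-BirchSwinnertonDyer-20727) — helper 4: at an odd prime `p` SPLIT in the imaginary quadratic
# field `K` with `p ∤ h_K`, the anticyclotomic `ℤ_p`-extension is TOTALLY non-split above `p`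
# (`AcSigned.IsNonsplitIn κ v`: the decomposition group surjects onto `Gal(K_∞⁻/K) ≅ ℤ_p`)

Width seat bsd-line-sbc-p1-w4 (gen 0), `--supports stmt-BirchSwinnertonDyer-20727`. The refereed facts
consumed for stub (a) (`AcSigned.castellaWan2024_proofThm68_transferInputs`,
`AcSigned.longoVigni2019_thm14_signedSelmerDual_rank_one`) quantify over a place `𝔭 ∣ p` with
`h𝔭 : AcSigned.IsNonsplitIn κ 𝔭` ("one prime of `K_∞` above `𝔭`", flag `localize-nonsplit`: "carried as a
hypothesis, not derived"). This file DERIVES it from the printed sufficient condition `p ∤ h_K` of the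
`AcSigned.Setting` (Hatley–Lei–Vigni §1.1: "the two primes of `K` above `p` are totally ramified in `K_∞`;
this … holds if `p` does not divide the class number of `K`"; Longo–Vigni Assumption 1.3; Brink 2007, proof
of Cor. 1), extending the tree's `ZpExtension.inertia_not_le_kerSubgroup_of_isAnticyclotomic` (Brink:
`K_∞⁻/K` is RAMIFIED above `p`) to TOTAL ramification at the first layer:
* §1 `inertia_le_comap_of_natCast_mem_of_inertia_le` — the pro-dihedral transport of the tree's
  `inertia_le_kerSubgroup_of_natCast_mem_of_inertia_le` for an ARBITRARY subgroup `N ≤ ℤ_p` in place of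
  `{0}` (same proof: `κ τ = κ σ` or `κ τ = (κ σ)⁻¹`);
* §2 `exists_mem_inertia_not_mem_layerSubgroup_one` — if every inertia group above `p` lay in
  `κ⁻¹(pℤ_p) = Gal(K̄/K_1)`, the first layer `K_1/K` (abelian of degree `p`) would be unramified
  everywhere (Washington Prop. 13.2 away from `p`; `p` odd at infinity), so `p ∣ h_K` (Hilbert class
  field, `hilbertClassField.finrank_dvd_classNumber_of_abelian`);
* §3 `isNonsplitIn_of_isAnticyclotomic_of_not_dvd_classNumber` — an element `σ ∈ I_𝔓 ≤ D_v` with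
  `κ σ ∈ ℤ_pˣ`; the image of the compact `Γ_{K_v}` is a closed subgroup of `ℤ_p` containing a unit,
  hence everything (`PadicInt.topologicalClosure_zpowers_ofAdd_one` after a unit twist).
Nothing here concerns an elliptic curve; BSD is not advanced by this file.

References: [Brink2007] Cor. 1 (p. 2136) and its proof; [HatleyLeiVigni2022] §1.1; [LongoVigni2019]
Assumption 1.3; [Washington1997] §13.1 Prop. 13.2; [Cox2013] §5.C Cor. 5.24.
-/

-- D-0017: single-problem summit, the namespace repeats the problem name by design.
set_option linter.dupNamespace false
set_option autoImplicit false

noncomputable section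

open scoped NumberField Pointwise

namespace Summit.BirchSwinnertonDyer.BirchSwinnertonDyer.Theorems.SignedBaseChangeAcDivAnticyclotomicNonsplit

open Field NumberField IsDedekindDomain
open Literature.NumberTheory.GaloisRepresentations Literature.NumberTheory.NumberFields
  Literature.NumberTheory.EllipticCurves Literature.NumberTheory.EllipticCurves.ZpExtension

/-! ## §0 Places of `ℚ` below the primes above `p` (bookkeeping) -/

section RatPlaces

/-- A place of a number field containing the rational prime `p` lies above the place `(p)` of `ℚ`.
[folklore] -/
theorem natCast_mem_under_rat {K : Type*} [Field K] [NumberField K]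
    {w : HeightOneSpectrum (𝓞 K)} {p : ℕ} (hpw : ((p : ℕ) : 𝓞 K) ∈ w.asIdeal) :
    (p : 𝓞 ℚ) ∈ (w.under (𝓞 ℚ)).asIdeal := by
  rw [HeightOneSpectrum.under_asIdeal, Ideal.under_def, Ideal.mem_comap, map_natCast]
  exact hpw

/-- Two places of a number field containing the same rational prime lie over the same place of `ℚ`.
[folklore] -/
theorem under_asIdeal_eq_of_natCast_mem {K : Type*} [Field K] [NumberField K] {p : ℕ}
    (hp : p.Prime) {v w : HeightOneSpectrum (𝓞 K)} (hpv : ((p : ℕ) : 𝓞 K) ∈ v.asIdeal)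
    (hpw : ((p : ℕ) : 𝓞 K) ∈ w.asIdeal) :
    v.asIdeal.under (𝓞 ℚ) = (w.under (𝓞 ℚ)).asIdeal := by
  rw [← Literature.NumberTheory.GaloisRepresentations.Rat.eq_of_natCast_prime_mem hp
    (natCast_mem_under_rat hpv) (natCast_mem_under_rat hpw)]
  exact (HeightOneSpectrum.under_asIdeal (𝓞 ℚ) v).symm

end RatPlaces

/-! ## §1 Pro-dihedral transport of an inertia condition between the primes above `p` -/

section Transport

variable {K : Type*} [Field K] [NumberField K] {p : ℕ} [Fact p.Prime]

/-- **Pro-dihedral symmetry for a general level**: for `[K : ℚ] = 2`, `κ` anticyclotomic and a subgroup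
`N ≤ ℤ_p`, if ONE inertia group `I_{𝔓₁}` (`𝔓₁ ∣ v ∣ p`) maps into `N` under `κ`, then EVERY inertia group
above ANY `w ∣ p` does — the tree's `inertia_le_kerSubgroup_of_natCast_mem_of_inertia_le` is the case
`N = 1`; the proof is the same (`Γ_ℚ` is transitive on the primes above `(p)`; for `τ ∈ I_𝔓`,
`ρ⁻¹ (res τ) ρ = res σ` with `σ ∈ I_{𝔓₁}`, and `κ τ = κ σ` or `κ τ = (κ σ)⁻¹`).
[cite: Brink2007, Cor. 1 (p. 2136) and §II Prop. 1 (p. 2130)] [cite: NeukirchANT1999, Ch. I §9 Prop. (9.1)] -/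
theorem inertia_le_comap_of_natCast_mem_of_inertia_le (hK : Module.finrank ℚ K = 2)
    (κ : ZpExtension K p) (hκ : κ.IsAnticyclotomic) (N : Subgroup (Multiplicative ℤ_[p]))
    {v : HeightOneSpectrum (𝓞 K)} (hpv : ((p : ℕ) : 𝓞 K) ∈ v.asIdeal)
    {𝔓₁ : Ideal (absIntegers (𝓞 K) K)} (h𝔓₁ : 𝔓₁ ∈ v.primesAbove)
    (hI₁ : 𝔓₁.inertia (absoluteGaloisGroup K) ≤ N.comap κ.toContinuousMonoidHom.toMonoidHom)
    {w : HeightOneSpectrum (𝓞 K)} (hpw : ((p : ℕ) : 𝓞 K) ∈ w.asIdeal)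
    {𝔓 : Ideal (absIntegers (𝓞 K) K)} (h𝔓 : 𝔓 ∈ w.primesAbove) :
    𝔓.inertia (absoluteGaloisGroup K) ≤ N.comap κ.toContinuousMonoidHom.toMonoidHom := by
  have hp : p.Prime := Fact.out
  -- the place `(p)` of `ℚ` below `v` and `w`
  have hvu : v.asIdeal.under (𝓞 ℚ) = (v.under (𝓞 ℚ)).asIdeal :=
    (HeightOneSpectrum.under_asIdeal (𝓞 ℚ) v).symm
  have hwu : w.asIdeal.under (𝓞 ℚ) = (v.under (𝓞 ℚ)).asIdeal :=
    under_asIdeal_eq_of_natCast_mem hp hpw hpv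
  -- the contracted primes of `\bar ℤ_ℚ` and the transporting element `ρ ∈ Γ_ℚ`
  have h𝔔 : 𝔓.comap (absIntegersMap ℚ K) ∈ (v.under (𝓞 ℚ)).primesAbove :=
    comap_absIntegersMap_mem_primesAbove hwu h𝔓
  have h𝔔₁ : 𝔓₁.comap (absIntegersMap ℚ K) ∈ (v.under (𝓞 ℚ)).primesAbove :=
    comap_absIntegersMap_mem_primesAbove hvu h𝔓₁
  obtain ⟨ρ, hρ⟩ := HeightOneSpectrum.exists_smul_eq_of_mem_primesAbove_holds h𝔔₁ h𝔔
  intro τ hτ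
  -- `ρ⁻¹ (res τ) ρ ∈ I_{ι⁻¹ 𝔓₁}`
  have h1 : absGaloisRestrict ℚ K τ ∈
      (ρ • 𝔓₁.comap (absIntegersMap ℚ K)).inertia (absoluteGaloisGroup ℚ) := by
    rw [hρ]
    exact absGaloisRestrict_mem_inertia_comap ℚ K hτ
  have h2 : ρ⁻¹ * absGaloisRestrict ℚ K τ * ρ ∈
      (𝔓₁.comap (absIntegersMap ℚ K)).inertia (absoluteGaloisGroup ℚ) :=
    (HeightOneSpectrum.mem_inertia_smul_absIntegers_iff ρ _ _).mp h1
  -- any `σ ∈ Γ_K` restricting to it lies in `I_{𝔓₁}`, hence maps into `N`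
  have key : ∀ σ : absoluteGaloisGroup K,
      absGaloisRestrict ℚ K σ = ρ⁻¹ * absGaloisRestrict ℚ K τ * ρ → κ σ ∈ N := by
    intro σ hσ
    have h3 : σ ∈ 𝔓₁.inertia (absoluteGaloisGroup K) := by
      rw [← comap_inertia_comap_absIntegersMap ℚ K 𝔓₁, Subgroup.mem_comap]
      change absGaloisRestrict ℚ K σ ∈ _
      rw [hσ]
      exact h2
    exact Subgroup.mem_comap.mp (hI₁ h3)
  rw [Subgroup.mem_comap]
  change κ τ ∈ N
  by_cases hρr : ρ ∈ Set.range (absGaloisRestrict ℚ K)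
  · -- `ρ = res σ₀`: `σ = σ₀⁻¹ τ σ₀ ∈ I_{𝔓₁}` and `κ τ = κ σ`
    obtain ⟨σ₀, rfl⟩ := hρr
    have hσ : absGaloisRestrict ℚ K (σ₀⁻¹ * τ * σ₀) =
        (absGaloisRestrict ℚ K σ₀)⁻¹ * absGaloisRestrict ℚ K τ * absGaloisRestrict ℚ K σ₀ := by
      rw [map_mul, map_mul, map_inv]
    have h4 := key _ hσ
    rwa [map_mul, map_mul, map_inv, mul_comm (κ σ₀)⁻¹ (κ τ), mul_assoc, inv_mul_cancel,
      mul_one] at h4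
  · -- `ρ ∉ res(Γ_K)`: index two gives `σ`, anticyclotomicity gives `κ τ = (κ σ)⁻¹`
    have hρ' : absGaloisRestrict ℚ K τ * ρ ∉ Set.range (absGaloisRestrict ℚ K) := by
      rintro ⟨σ', hσ'⟩
      exact hρr ⟨τ⁻¹ * σ', by rw [map_mul, map_inv, hσ', ← mul_assoc, inv_mul_cancel, one_mul]⟩
    obtain ⟨σ, hσ⟩ := inv_mul_mem_range_absGaloisRestrict hK hρr hρ'
    have hσ' : absGaloisRestrict ℚ K σ = ρ⁻¹ * absGaloisRestrict ℚ K τ * ρ := by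
      rw [hσ, mul_assoc]
    have h4 := key σ hσ'
    have h5 : κ τ = (κ σ)⁻¹ := hκ σ τ ρ hρr (by rw [hσ']; group)
    rw [h5]
    exact N.inv_mem h4

end Transport

/-! ## §2 `p ∤ h_K` ⟹ some inertia element above `p` acts non-trivially on the FIRST layer -/

section ClassNumber

variable {K : Type} [Field K] [NumberField K] {p : ℕ} [Fact p.Prime]

omit [NumberField K] in
/-- The subgroup `pℤ_p ≤ ℤ_p` (multiplicative notation), whose preimage under `κ` is the first layer
subgroup `κ⁻¹(pℤ_p) = Gal(K̄/K_1)` (`ZpExtension.layerSubgroup κ 1`, definitionally). [folklore] -/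
theorem layerSubgroup_one_eq_comap (κ : ZpExtension K p) :
    κ.layerSubgroup 1 =
      (AddSubgroup.toSubgroup (Ideal.span {(p : ℤ_[p]) ^ 1}).toAddSubgroup).comap
        κ.toContinuousMonoidHom.toMonoidHom :=
  rfl

/-- **A `ℤ_p`-extension all of whose inertia groups act trivially on the layer `K_n` has `K_n/K`
unramified at every finite place** (the tree's `isUnramifiedIn_layer_of_forall_inertia_le` with its
hypothesis `I_𝔓 ≤ ker κ` weakened to `I_𝔓 ≤ Gal(K̄/K_n)`, which is all its proof uses).
[cite: NeukirchANT1999, Ch. VII §10 Thm. (10.6) (proof)] [cite: Washington1997, §13.1] -/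
theorem isUnramifiedIn_layer_of_forall_inertia_le_layerSubgroup (κ : ZpExtension K p) (n : ℕ)
    (h : ∀ (w : HeightOneSpectrum (𝓞 K)) (𝔓 : Ideal (absIntegers (𝓞 K) K)),
      𝔓 ∈ w.primesAbove → 𝔓.inertia (absoluteGaloisGroup K) ≤ κ.layerSubgroup n)
    (w : HeightOneSpectrum (𝓞 K)) :
    Algebra.IsUnramifiedIn (𝓞 (κ.layer n)) w.asIdeal := by
  haveI : FiniteDimensional K (κ.layer n) := κ.finiteDimensional_layer_holds n
  haveI : IsGalois K (κ.layer n) := κ.isGalois_layer_holds n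
  rw [isUnramifiedIn_iff_forall_inertia_absRestrictNormalHom_eq_one]
  intro 𝔓 h𝔓 g hg
  have hg' : g ∈ κ.layerSubgroup n := h w 𝔓 h𝔓 hg
  rw [absRestrictNormalHom_eq_one_iff_forall_smul]
  intro x
  have hfix : absoluteGaloisGroup.toAlgEquiv K g ∈ (κ.layer n).fixingSubgroup := by
    rw [κ.fixingSubgroup_layer n]
    exact ⟨g, hg', rfl⟩
  rw [IntermediateField.mem_fixingSubgroup_iff] at hfix
  rw [absoluteGaloisGroup.smul_def]
  exact hfix x x.2

/-- **`p ∤ h_K` ⟹ the anticyclotomic tower is TOTALLY ramified above `p` at the first step**: for `K`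
imaginary quadratic, `p` odd with `p ∤ h_K`, `κ` anticyclotomic and any prime `𝔓` of `\bar ℤ_K` above a
place `v ∣ p`, some `σ ∈ I_𝔓` does NOT lie in `Gal(K̄/K_1) = κ⁻¹(pℤ_p)` (i.e. `κ σ ∈ ℤ_pˣ`). Otherwise, by
§1 every inertia group above `p` lies in `Gal(K̄/K_1)`, and so does every inertia group away from `p`
(`inertia_le_kerSubgroup_holds`, Washington Prop. 13.2); then `K_1/K` — abelian of degree `p`, unramified
at all finite places and at infinity (`p` odd) — lies in the Hilbert class field, `p ∣ h_K`.
[cite: Brink2007, Cor. 1 (p. 2136) and its proof] [cite: HatleyLeiVigni2022, §1.1]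
[cite: Washington1997, §13.1 Prop. 13.2] [cite: Cox2013, §5.C Cor. 5.24 and §8.A Thm. 8.10] -/
theorem exists_mem_inertia_not_mem_layerSubgroup_one (hK : IsImaginaryQuadratic K) (hp2 : p ≠ 2)
    (κ : ZpExtension K p) (hκ : κ.IsAnticyclotomic) (hh : ¬ p ∣ NumberField.classNumber K)
    {v : HeightOneSpectrum (𝓞 K)} (hpv : ((p : ℕ) : 𝓞 K) ∈ v.asIdeal)
    {𝔓 : Ideal (absIntegers (𝓞 K) K)} (h𝔓 : 𝔓 ∈ v.primesAbove) :
    ∃ σ ∈ 𝔓.inertia (absoluteGaloisGroup K), σ ∉ κ.layerSubgroup 1 := by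
  by_contra hcon
  push Not at hcon
  have hle : 𝔓.inertia (absoluteGaloisGroup K) ≤ κ.layerSubgroup 1 := fun σ hσ ↦ hcon σ hσ
  have hp : p.Prime := Fact.out
  -- every inertia group lies in `Gal(K̄/K_1)`
  have hI : ∀ (w : HeightOneSpectrum (𝓞 K)) (𝔓' : Ideal (absIntegers (𝓞 K) K)),
      𝔓' ∈ w.primesAbove → 𝔓'.inertia (absoluteGaloisGroup K) ≤ κ.layerSubgroup 1 := by
    intro w 𝔓' h𝔓'
    by_cases hpw : ((p : ℕ) : 𝓞 K) ∈ w.asIdeal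
    · rw [layerSubgroup_one_eq_comap] at hle ⊢
      exact inertia_le_comap_of_natCast_mem_of_inertia_le hK.1 κ hκ _ hpv h𝔓 hle hpw h𝔓'
    · exact (inertia_le_kerSubgroup_holds K p κ hpw h𝔓').trans (κ.kerSubgroup_le_layerSubgroup 1)
  -- so the first layer, of degree `p`, lies in the Hilbert class field
  haveI : FiniteDimensional K (κ.layer 1) := κ.finiteDimensional_layer_holds 1
  haveI : IsGalois K (κ.layer 1) := κ.isGalois_layer_holds 1
  haveI : IsAbelianGalois K (κ.layer 1) := κ.isAbelianGalois_layer 1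
  haveI : NumberField (κ.layer 1) := NumberField.of_module_finite K (κ.layer 1)
  haveI : IsUnramifiedAtInfinitePlaces K (κ.layer 1) :=
    IsUnramifiedAtInfinitePlaces_of_odd_finrank
      (by rw [κ.finrank_layer_holds 1]; exact (hp.odd_of_ne_two hp2).pow)
  have hdvd := hilbertClassField.finrank_dvd_classNumber_of_abelian K (κ.layer 1)
    (fun w ↦ isUnramifiedIn_layer_of_forall_inertia_le_layerSubgroup κ 1 hI w)
  rw [κ.finrank_layer_holds 1, pow_one] at hdvd
  exact hh hdvd

end ClassNumber

/-! ## §3 Total non-splitting: `AcSigned.IsNonsplitIn κ v` -/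

section Nonsplit

variable {K : Type} [Field K] [NumberField K] {p : ℕ} [Fact p.Prime]

/-- A closed subgroup of `ℤ_p` (multiplicative notation) containing `1` is everything
(`ℤ` is dense in `ℤ_p`, `PadicInt.topologicalClosure_zpowers_ofAdd_one`). [folklore] -/
theorem eq_top_of_isClosed_of_ofAdd_one_mem (M : Subgroup (Multiplicative ℤ_[p]))
    (hM : IsClosed (M : Set (Multiplicative ℤ_[p]))) (h1 : Multiplicative.ofAdd (1 : ℤ_[p]) ∈ M) :
    M = ⊤ := by
  rw [eq_top_iff, ← PadicInt.topologicalClosure_zpowers_ofAdd_one]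
  exact Subgroup.topologicalClosure_minimal _ ((Subgroup.zpowers_le (G := Multiplicative ℤ_[p])).mpr h1) hM

/-- **`p ∤ h_K` ⟹ the anticyclotomic `ℤ_p`-extension is totally non-split above `p`**
(`AcSigned.IsNonsplitIn κ v`: `κ ∘ res_v : Γ_{K_v} → Γ_K → ℤ_p` is SURJECTIVE, i.e. the decomposition
group of the chosen prime above `v` is all of `Gal(K_∞⁻/K)` — "the two primes of `K` above `p` are totally
ramified in `K_∞`; this … holds if `p` does not divide the class number of `K`"), for `K` imaginary
quadratic, `p` odd, `κ` anticyclotomic, `v ∣ p`. Proof: §2 gives `σ` in the inertia group of the prime cut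
out by the embedding `K̄ → K̄_v` (`⊆ D_v`, `inertia_adicCompletionPrime_le_decomp`) with `κ σ = u ∈ ℤ_pˣ`; the
image of `Γ_{K_v}` under the unit twist `u⁻¹κ` is a closed subgroup of `ℤ_p` containing `1`, hence `ℤ_p`.
[cite: HatleyLeiVigni2022, §1.1] [cite: LongoVigni2019, Assumption 1.3 (arXiv:1503.07812 p. 3)]
[cite: Brink2007, Cor. 1 (p. 2136)] -/
theorem isNonsplitIn_of_isAnticyclotomic_of_not_dvd_classNumber (hK : IsImaginaryQuadratic K)
    (hp2 : p ≠ 2) (κ : ZpExtension K p) (hκ : κ.IsAnticyclotomic)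
    (hh : ¬ p ∣ NumberField.classNumber K) {v : HeightOneSpectrum (𝓞 K)}
    (hpv : ((p : ℕ) : 𝓞 K) ∈ v.asIdeal) : AcSigned.IsNonsplitIn κ v := by
  have hp : p.Prime := Fact.out
  -- an inertia element above `v` with unit value
  obtain ⟨σ, hσI, hσ1⟩ := exists_mem_inertia_not_mem_layerSubgroup_one hK hp2 κ hκ hh hpv
    (adicCompletionPrime_mem_primesAbove K v)
  have hσD : σ ∈ GreenbergSelmer.decomp v := inertia_adicCompletionPrime_le_decomp v hσI
  rw [mem_layerSubgroup, pow_one] at hσ1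
  have hunit : IsUnit (κ σ).toAdd := by
    by_contra hnu
    apply hσ1
    have hlt : ‖(κ σ).toAdd‖ < 1 := PadicInt.mem_nonunits.mp hnu
    exact (PadicInt.norm_lt_one_iff_dvd _).mp hlt
  obtain ⟨u, hu⟩ := hunit
  -- the unit twist `κ' = u⁻¹ κ` has `κ' σ = 1`
  set κ' : ZpExtension K p := κ.unitTwist u⁻¹ with hκ'
  have hκ'σ : κ' σ = Multiplicative.ofAdd 1 := by
    rw [hκ', unitTwist_apply, ← hu, Units.inv_mul]
  -- the image of `Γ_{K_v}` under `κ' ∘ res_v` is closed and contains `1`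
  obtain ⟨τ₀, hτ₀⟩ := (GreenbergSelmer.mem_decomp_iff v σ).1 hσD
  set f : absoluteGaloisGroup (v.adicCompletion K) →ₜ* Multiplicative ℤ_[p] :=
    κ'.toContinuousMonoidHom.comp (resGal (K := K) (v.adicCompletion K)) with hf
  haveI : CompactSpace (absoluteGaloisGroup (v.adicCompletion K)) := absoluteGaloisGroup_compactSpace _
  have hclosed : IsClosed ((f.toMonoidHom.range : Subgroup (Multiplicative ℤ_[p])) :
      Set (Multiplicative ℤ_[p])) := by
    rw [MonoidHom.coe_range]
    exact (isCompact_range f.continuous_toFun).isClosed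
  have h1 : Multiplicative.ofAdd (1 : ℤ_[p]) ∈ f.toMonoidHom.range := by
    refine ⟨τ₀, ?_⟩
    change κ' (absGaloisRestrict K (v.adicCompletion K) τ₀) = _
    rw [hτ₀, hκ'σ]
  have htop := eq_top_of_isClosed_of_ofAdd_one_mem _ hclosed h1
  -- surjectivity of `κ ∘ res_v`
  intro y
  have hy : Multiplicative.ofAdd ((↑u⁻¹ : ℤ_[p]) * y.toAdd) ∈ f.toMonoidHom.range :=
    htop ▸ Subgroup.mem_top _
  obtain ⟨τ, hτ⟩ := hy
  refine ⟨τ, ?_⟩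
  change κ' (resGal (K := K) (v.adicCompletion K) τ) = _ at hτ
  rw [hκ', unitTwist_apply] at hτ
  have hτ' := congrArg (fun z ↦ (u : ℤ_[p]) * Multiplicative.toAdd z) hτ
  simp only [toAdd_ofAdd, ← mul_assoc, Units.mul_inv, one_mul] at hτ'
  change κ (resGal (K := K) (v.adicCompletion K) τ) = y
  rw [← ofAdd_toAdd (κ _), hτ', ofAdd_toAdd]

end Nonsplit

end Summit.BirchSwinnertonDyer.BirchSwinnertonDyer.Theorems.SignedBaseChangeAcDivAnticyclotomicNonsplit

end
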